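import Mathlib
import Summits.Ventures.PercRepro2.Defs
import Summits.Ventures.PercRepro2.Independence
import Summits.Ventures.PercRepro2.Graph
import Summits.Ventures.PercRepro2.Induced
import Summits.Ventures.PercRepro2.DisagreementSum
import Summits.Ventures.PercRepro2.DisagreementPinned
import Summits.Ventures.PercRepro2.HullDefs
import Summits.Ventures.PercRepro2.HullFlip
import Summits.Ventures.PercRepro2.HullPieceFlip
import Summits.Ventures.PercRepro2.SwitchDefs

/-!
# The cluster-swap domination: the series lemma of the cut-vertex reduction of (BASE)
(blind cell PercRepro2, mine-2 g10; `proofs/MINE2-CUTVERTEX.md` §1)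

On the minor with free edges `G` (pinned edges keep their colour in both copies; the blue graph of
`ζ` is `flipOn G ζ`), fix a root `l`, a vertex `x` and a target `o`. **Cluster-swap domination**:
for every family `𝒳` of vertex sets none of which contains `l`,

  `#{ζ = z off G : C_R(x) ∈ 𝒳, o ∈ C_R(l)} ≤ #{ζ = z off G : C_B(x) ∈ 𝒳, o ∈ C_R(l)}`

(`card_clusterFamily_le`), pointwise in `X = C_R(x)` (`card_clusterEq_le`). PROOF: explore the red
cluster `X` of `x` and flip every free edge touching it (`Switch.freeFlip G X`). The blue graph of
the image agrees with `ζ` on every edge touching `X` (free edges are flipped twice, pinned edges are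
the same in both colours), so by the domain Markov property `C_B(x)` becomes exactly `X`
(`cluster_flipOn_freeFlip_eq`); the red cluster of `l` never meets `X` (it would contain `x`), so
the red path `l → o` uses no edge touching `X` and survives (`conn_freeFlip_of_conn`, from
`Hull.conn_of_eqOn_off_touches`); the map is injective because `X` is recovered from the image as
`C_B(x)` and the flip is an involution (`freeFlip_freeFlip`).

The instance `𝒳 = {X : b ∈ X, l ∉ X}` is the SERIES LEMMA (SER)
  `#{x ∉ C_R(l), b ∈ C_R(x), o ∈ C_R(l)} ≤ #{x ∉ C_B(l), b ∈ C_B(x), o ∈ C_R(l)}`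
(`card_ser_le`), i.e. `Ψ(G; l, x, o, b) ≤ 0` in the notation of the proofs file, which closes the
cut-vertex composition of the (BASE) functional: for a cut vertex `x` separating `l` from `h` with
`o, b` on the side `A` of `l`, `Φ(G) = N₂₂ · Φ(A; l, x, o, b) − 2 N₂₁ · Ψ(A; l, x, o, b)`, and
(BASE) on `G` follows from (BASE) on the smaller graph `A` (paper: MINE2-CUTVERTEX.md §2, with the
split cases `Φ(G) = 2 S_A S_B ≥ 0` by Harris). Census of (SER): `0` violations on every connected
graph with `n ≤ 6` (40,320 quadruples at `n = 6`) — the theorem makes the census a check.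
-/

namespace Summit.Ventures.PercRepro2

namespace Ser

open Hull Switch

open scoped Classical

variable {V : Type*} {E : Type*} [DecidableEq E]

variable {ends : E → Sym2 V} {G : Finset E}

/-! ## The flip of the closure of a cluster -/

/-- `freeFlip` is an involution. -/
lemma freeFlip_freeFlip (S : Set V) (ζ : Config E) :
    freeFlip ends G S (freeFlip ends G S ζ) = ζ := by
  funext e
  by_cases h : e ∈ G ∧ e ∈ touches ends S
  · rw [freeFlip_apply_of_mem h.1 h.2, freeFlip_apply_of_mem h.1 h.2, Bool.not_not]
  · rw [freeFlip_apply_of_not h, freeFlip_apply_of_not h]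

/-- `freeFlip` changes only free edges: the pinned values are kept. -/
lemma freeFlip_eq_of_notMem {S : Set V} {ζ : Config E} {e : E} (he : e ∉ G) :
    freeFlip ends G S ζ e = ζ e :=
  freeFlip_apply_of_not (fun h => he h.1)

/-- The blue graph of `freeFlip G X ζ` agrees with the red graph `ζ` on every edge touching `X`
(free edges are flipped twice, pinned edges carry the same colour in both copies). -/
lemma flipOn_freeFlip_eq_of_mem_touches {X : Set V} {ζ : Config E} {e : E}
    (he : e ∈ touches ends X) : flipOn G (freeFlip ends G X ζ) e = ζ e := by
  by_cases hG : e ∈ G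
  · exact flipOn_freeFlip_apply_of_mem hG he
  · rw [flipOn_of_notMem G _ hG, freeFlip_eq_of_notMem hG]

/-- **Exploring the red cluster of `x` and flipping its closure makes it the blue cluster of
`x`**: if `C_R(x) = X` then `C_B(x)` of `freeFlip G X ζ` is `X`. -/
theorem cluster_flipOn_freeFlip_eq {ζ : Config E} {x : V} {X : Set V}
    (hX : cluster ends ζ x = X) :
    cluster ends (flipOn G (freeFlip ends G X ζ)) x = X :=
  cluster_eq_of_eqOn_touches (fun _ he => (flipOn_freeFlip_eq_of_mem_touches he).symm) hX

/-- A red connection from a vertex `l` outside `X = C_R(x)` survives the flip of the closure of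
`X`: its path never meets `X`. -/
theorem conn_freeFlip_of_conn {ζ : Config E} {x l o : V} {X : Set V}
    (hX : cluster ends ζ x = X) (hl : l ∉ X) (hc : Conn ends ζ l o) :
    Conn ends (freeFlip ends G X ζ) l o := by
  subst hX
  exact conn_of_eqOn_off_touches (l := x) (le_refl _) hl
    (fun e he => freeFlip_apply_of_not (fun h => he h.2)) hc

/-! ## The counting statements -/

variable [Fintype E]

omit [Fintype E] in
/-- `freeFlip` stays in the fibre of the minor `(G, z)` (`ζ = z` off `G`). -/
lemma fibre_freeFlip {z ζ : Config E} (S : Set V) (hζ : ∀ e, e ∉ G → ζ e = z e) :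
    ∀ e, e ∉ G → freeFlip ends G S ζ e = z e := fun e he => by
  rw [freeFlip_eq_of_notMem he]; exact hζ e he

/-- **Pointwise cluster-swap domination**: for every `X ∌ l`,
`#{ζ = z off G : C_R(x) = X, o ∈ C_R(l)} ≤ #{ζ = z off G : C_B(x) = X, o ∈ C_R(l)}`. -/
theorem card_clusterEq_le (z : Config E) (x l o : V) (X : Set V) (hl : l ∉ X) :
    (Finset.univ.filter fun ζ : Config E =>
        (∀ e, e ∉ G → ζ e = z e) ∧ cluster ends ζ x = X ∧ o ∈ cluster ends ζ l).card ≤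
      (Finset.univ.filter fun ζ : Config E =>
        (∀ e, e ∉ G → ζ e = z e) ∧ cluster ends (flipOn G ζ) x = X ∧ o ∈ cluster ends ζ l).card := by
  refine Finset.card_le_card_of_injOn (fun ζ => freeFlip ends G X ζ) ?_ ?_
  · intro ζ hζ
    simp only [Finset.coe_filter, Finset.mem_univ, true_and, Set.mem_setOf_eq] at hζ ⊢
    exact ⟨fibre_freeFlip X hζ.1, cluster_flipOn_freeFlip_eq hζ.2.1,
      conn_freeFlip_of_conn hζ.2.1 hl hζ.2.2⟩
  · intro ζ₁ _ ζ₂ _ h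
    have := congrArg (freeFlip ends G X) h
    simpa only [freeFlip_freeFlip] using this

/-- **Cluster-swap domination for a family**: for every family `𝒳` of vertex sets not
containing `l`, `#{ζ = z off G : C_R(x) ∈ 𝒳, o ∈ C_R(l)} ≤ #{ζ = z off G : C_B(x) ∈ 𝒳, o ∈ C_R(l)}`.
The injection flips the closure of the red cluster of `x` of each configuration. -/
theorem card_clusterFamily_le (z : Config E) (x l o : V) (𝒳 : Set (Set V))
    (h𝒳 : ∀ X ∈ 𝒳, l ∉ X) :
    (Finset.univ.filter fun ζ : Config E =>
        (∀ e, e ∉ G → ζ e = z e) ∧ cluster ends ζ x ∈ 𝒳 ∧ o ∈ cluster ends ζ l).card ≤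
      (Finset.univ.filter fun ζ : Config E =>
        (∀ e, e ∉ G → ζ e = z e) ∧ cluster ends (flipOn G ζ) x ∈ 𝒳 ∧ o ∈ cluster ends ζ l).card := by
  refine Finset.card_le_card_of_injOn (fun ζ => freeFlip ends G (cluster ends ζ x) ζ) ?_ ?_
  · intro ζ hζ
    simp only [Finset.coe_filter, Finset.mem_univ, true_and, Set.mem_setOf_eq] at hζ ⊢
    have hX := cluster_flipOn_freeFlip_eq (ends := ends) (G := G) (ζ := ζ) (x := x) rfl
    exact ⟨fibre_freeFlip _ hζ.1, by rw [hX]; exact hζ.2.1,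
      conn_freeFlip_of_conn rfl (h𝒳 _ hζ.2.1) hζ.2.2⟩
  · intro ζ₁ _ ζ₂ _ h
    simp only at h
    -- the red cluster of `x` is recovered from the image as its blue cluster
    have hX : cluster ends ζ₁ x = cluster ends ζ₂ x := by
      have h₁ := cluster_flipOn_freeFlip_eq (ends := ends) (G := G) (ζ := ζ₁) (x := x) rfl
      have h₂ := cluster_flipOn_freeFlip_eq (ends := ends) (G := G) (ζ := ζ₂) (x := x) rfl
      rw [h] at h₁
      exact h₁.symm.trans h₂
    have := congrArg (freeFlip ends G (cluster ends ζ₂ x)) h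
    rw [hX, freeFlip_freeFlip, freeFlip_freeFlip] at this
    exact this

/-- **The series lemma (SER)**: `#{x ∉ C_R(l), b ∈ C_R(x), o ∈ C_R(l)} ≤ #{x ∉ C_B(l), b ∈ C_B(x),
o ∈ C_R(l)}` on every minor — `Ψ(G; l, x, o, b) ≤ 0`. -/
theorem card_ser_le (z : Config E) (l x o b : V) :
    (Finset.univ.filter fun ζ : Config E =>
        (∀ e, e ∉ G → ζ e = z e) ∧ (x ∉ cluster ends ζ l ∧ b ∈ cluster ends ζ x) ∧ o ∈ cluster ends ζ l).card ≤
      (Finset.univ.filter fun ζ : Config E =>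
        (∀ e, e ∉ G → ζ e = z e) ∧ (x ∉ cluster ends (flipOn G ζ) l ∧ b ∈ cluster ends (flipOn G ζ) x) ∧
          o ∈ cluster ends ζ l).card := by
  have key := card_clusterFamily_le (ends := ends) (G := G) z x l o {X | l ∉ X ∧ b ∈ X}
    (fun _ hX => hX.1)
  -- `x ∉ C(l) ↔ l ∉ C(x)`
  have hsym : ∀ (ω : Config E), x ∉ cluster ends ω l ↔ l ∉ cluster ends ω x := fun ω => by
    simp only [mem_cluster]
    exact ⟨fun h hc => h (conn_symm hc), fun h hc => h (conn_symm hc)⟩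
  convert key using 3 <;> simp only [Set.mem_setOf_eq, hsym]

end Ser

end Summit.Ventures.PercRepro2
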